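import Literature.Analysis.FluidPDE.NSQuasipotential
import Summits.NavierStokesRegularity.NavierStokesRegularity.Theorems.StableStrataDoorInstances
import Summits.NavierStokesRegularity.NavierStokesRegularity.Theorems.StableStrataDoorOneSliceAxiPropagation
import Summits.NavierStokesRegularity.NavierStokesRegularity.Theorems.StableStrataDoorOneSliceSeqDoor

/-!
# StableStrataDoorOneSliceAxiSeq — SEED-26 «the SEQUENTIAL ε-door» of door S26 «StableStrataDoor», CONSUMER part 2/2:
the doors **T-axi-seq** `TargetSeqAxisymAt ν M A` (every axis) and **T-quiet-seq** `SeqDoorAt (quietPhi U) ν M`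
PROVED MODULO I1 ONLY (`StableStrataDoorOneSliceDefs.LocalPointZoomAlongTimesM`, v5 form; DIRECTOR-NS #82 (4)), and
the split I1 ⇐ I1a + I1b

§6 and §8 of the nsreg-p1 design `…/ns-regularity-ideate-p1/r25/seed26/Sketch26A.lean` (v5, sha16 bb69eb44dfa09fc3),
texts VERBATIM, instantiated at the tree's S26 instances: (H1)/(H2) for the axisymmetry defect
(`StableStrataDoorInstances.isWindowLsc_axiPhi` / `spreadsTo_axiPhi`), (H3) `stratumLiouville_axi` (KNSS), I2a
`StableStrataDoorFloorSurvives.floorSurvives_holds` and I2b `StableStrataDoorOneSliceAxiPropagation.oneSliceAxiPropagation_holds`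
(nsreg-p6 g14) are TREE THEOREMS, so of the design's three inputs only I1 remains:

* §6 `oneSliceLiouville_of_propagation` (generic: one-slice membership that propagates + (H3) ⇒ one-slice Liouville),
  `oneSliceLiouville_axi_of` (I2b ⇒ one-slice axisymmetric Type-I Liouville), **`oneSliceLiouville_axi`** (unconditional,
  every axis, every `D`); the text **`TargetSeqAxisymAt ν M A`** (door T-axi-seq: «space–time local Type I (`M`) at
  `(x₀,T)` + axisymmetry defect about `x₀ + ℝ·A e₃` at most `ε` on `U` ALONG SOME SEQUENCE `tₙ → T⁻`» is impossible at a
  singular point — the blow-up keeps a UNIFORM distance from axisymmetry); `targetSeqAxisymAt_of` (design signature);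
* §8 **`targetSeqAxisymAt_of_zoom (hν) (A) (h₁ : LocalPointZoomAlongTimesM) : TargetSeqAxisymAt ν M A`** — door
  T-axi-seq for EVERY axis modulo I1 only; `targetEpsAxisymAt_of_seq` (T-axi-seq ⇒ S26's eventual door T-axi
  `TargetEpsAxisymAt ν M A`, same `ε`); the null stratum: `oneSliceLiouville_quiet` (one vanishing slice ⇒ the classical
  Type-I solution vanishes — one-slice uniqueness `eq_of_eq_slice_classical` against the rest state) and
  **`seqDoorAt_quiet`** — door T-quiet-seq «no Type-I blow-up whose similarity window is ε-quiet along SOME sequence of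
  times» modulo I1 only; `localPointZoomAlongTimesM_of_split` (I1 ⇐ I1a `LocalPointZoomAlongTimesSing` + I1b
  `SingularProfileFloor`, the space–time decay of the limit being the tree's `hasTypeIDecay_of_zoom`).

Door family of LADDER-NS N0 (door S26 / SEED-26; `--supports stmt-NavierStokesRegularity-0056`, helper lane
ns-door-S23-p1).  No route, no items.
WHAT THIS IS NOT: not NS regularity (Clay (A)) and not a dent in `NoTypeII` (stmt-0056) — sequential ε-criteria INSIDE
the Type-I class, conditional on the typed input I1 (nsreg-p6 lane); not the swirl hard cores (every statement carries a
Type-I hypothesis); `ε` comes from compactness and is NOT explicit.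
-/

noncomputable section

set_option linter.dupNamespace false

namespace Summit.NavierStokesRegularity.NavierStokesRegularity.Theorems.StableStrataDoorOneSliceAxiSeq

open MeasureTheory Set Function Filter Topology TopologicalSpace Metric
open scoped RealInnerProductSpace NNReal ENNReal Topology Pointwise
open Literature.Analysis Literature.Analysis.FluidPDE
open Summit.NavierStokesRegularity.NavierStokesRegularity.Theorems.PoloidalWindowDoorPoloidalWindowRigidityWindow
open Summit.NavierStokesRegularity.NavierStokesRegularity.Theorems.ZoomReturnDoorDefs
open Summit.NavierStokesRegularity.NavierStokesRegularity.Theorems.StableStrataDoorDefs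
open Summit.NavierStokesRegularity.NavierStokesRegularity.Theorems.StableStrataDoorWindowLimit
open Summit.NavierStokesRegularity.NavierStokesRegularity.Theorems.StableStrataDoorSchema
open Summit.NavierStokesRegularity.NavierStokesRegularity.Theorems.StableStrataDoorInstances
open Summit.NavierStokesRegularity.NavierStokesRegularity.Theorems.StableStrataDoorOneSliceDefs
open Summit.NavierStokesRegularity.NavierStokesRegularity.Theorems.StableStrataDoorFloorSurvives
open Summit.NavierStokesRegularity.NavierStokesRegularity.Theorems.StableStrataDoorOneSliceAxiPropagation
open Summit.NavierStokesRegularity.NavierStokesRegularity.Theorems.StableStrataDoorOneSliceSeqDoor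

variable {𝔖 : Set (EuclideanSpace ℝ (Fin 3) → EuclideanSpace ℝ (Fin 3))}

/-! ## §6 The axisymmetric instance — I2b + KNSS ⇒ one-slice Liouville; the door text T-axi-seq -/

/-- **one-slice Liouville from propagation (generic):** if membership of ONE slice in the stratum propagates to every
slice of a classical Type-I(`D`) solution on the past, the stratum Liouville theorem (H3) `StratumLiouville 𝔖 D` gives the
one-slice Liouville theorem `OneSliceLiouville 𝔖 D`. -/
theorem oneSliceLiouville_of_propagation {D : ℝ}
    (hprop : ∀ (V : ℝ → EuclideanSpace ℝ (Fin 3) → EuclideanSpace ℝ (Fin 3)) (q : ℝ → EuclideanSpace ℝ (Fin 3) → ℝ),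
      IsClassicalNSSolutionOn (Set.Iio 0) 1 0 V q → HasTypeIDecay D V → ∀ s₀ < 0, V s₀ ∈ 𝔖 → ∀ τ < 0, V τ ∈ 𝔖)
    (hLiou : StratumLiouville 𝔖 D) : OneSliceLiouville 𝔖 D :=
  fun V q hcl hdec s₀ hs₀ hmem => hLiou V q hcl hdec (hprop V q hcl hdec s₀ hs₀ hmem)

/-- **one-slice axisymmetric Type-I Liouville theorem** from I2b and the tree's KNSS theorem (any axis, swirl allowed;
(H3) `StableStrataDoorInstances.stratumLiouville_axi`). -/
theorem oneSliceLiouville_axi_of (A : EuclideanSpace ℝ (Fin 3) ≃ₗᵢ[ℝ] EuclideanSpace ℝ (Fin 3)) {D : ℝ}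
    (hprop : OneSliceAxiPropagation A D) : OneSliceLiouville (axiStratum A) D :=
  oneSliceLiouville_of_propagation (fun V q hcl hdec s₀ hs₀ hmem => hprop V q hcl hdec s₀ hs₀ hmem)
    (stratumLiouville_axi A D)

/-- **one-slice axisymmetric Type-I Liouville theorem, UNCONDITIONAL** (I2b is the tree theorem
`oneSliceAxiPropagation_holds`): a classical Type-I(`D`) solution on `(−∞,0) × ℝ³` with ONE axisymmetric slice vanishes. -/
theorem oneSliceLiouville_axi (A : EuclideanSpace ℝ (Fin 3) ≃ₗᵢ[ℝ] EuclideanSpace ℝ (Fin 3)) (D : ℝ) :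
    OneSliceLiouville (axiStratum A) D :=
  oneSliceLiouville_axi_of A (oneSliceAxiPropagation_holds A D)


/-- **DOOR T-axi-seq** at constants `ν, M`, axis `A e₃`: for every bounded open nonempty window `U` some `ε(ν, M, A, U) > 0`
makes «space–time local Type I (`M`) at `(x₀,T)` + axisymmetry defect about `x₀ + ℝ·A e₃` at most `ε` on `U` at every
angle ALONG SOME SEQUENCE `tₙ → T⁻`» impossible at a singular point — the blow-up keeps a uniform distance from axisymmetry. -/
def TargetSeqAxisymAt (ν M : ℝ) (A : EuclideanSpace ℝ (Fin 3) ≃ₗᵢ[ℝ] EuclideanSpace ℝ (Fin 3)) : Prop :=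
  ∀ (U : Set (EuclideanSpace ℝ (Fin 3))), IsOpen U → U.Nonempty → Bornology.IsBounded U → SeqDoorAt (axiPhi A U) ν M

/-- **THE HEADLINE, design signature** (door T-axi-seq from I1, I2a, I2b and the instance lemmas (H1)/(H2) as hypotheses;
all but I1 are discharged below in `targetSeqAxisymAt_of_zoom`). -/
theorem targetSeqAxisymAt_of {ν M : ℝ} (hν : 0 < ν) (A : EuclideanSpace ℝ (Fin 3) ≃ₗᵢ[ℝ] EuclideanSpace ℝ (Fin 3))
    (h₁ : LocalPointZoomAlongTimesM) (h₂ : ∀ D c : ℝ, 0 < D → 0 < c → FloorSurvives D c)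
    (h₃ : ∀ D : ℝ, 0 < D → OneSliceAxiPropagation A D)
    (hlsc : ∀ U : Set (EuclideanSpace ℝ (Fin 3)), IsWindowLsc (axiPhi A U))
    (hspread : ∀ U : Set (EuclideanSpace ℝ (Fin 3)), IsOpen U → U.Nonempty → SpreadsTo (axiPhi A U) (axiStratum A) ν) :
    TargetSeqAxisymAt ν M A := fun U hU hne _ =>
  seqDoorAt_of h₁ (hlsc U) hν fun c hc hD =>
    oneSliceResidue_of hD (hlsc U) (hspread U hU hne) (h₂ (M / ν) c hD hc) (oneSliceLiouville_axi_of A (h₃ (M / ν) hD))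

/-! ## §8 THE HEADLINES MODULO I1 ONLY (I2a, I2b, (H1), (H2), (H3) are tree theorems) -/

/-- **T-axi-seq from I1 `LocalPointZoomAlongTimesM`, I2b `OneSliceAxiPropagation` and the instance lemmas (H1)/(H2)**
(design signature; I2a discharged by the tree's `floorSurvives_holds`). -/
theorem targetSeqAxisymAt_of_two {ν M : ℝ} (hν : 0 < ν) (A : EuclideanSpace ℝ (Fin 3) ≃ₗᵢ[ℝ] EuclideanSpace ℝ (Fin 3))
    (h₁ : LocalPointZoomAlongTimesM) (h₃ : ∀ D : ℝ, 0 < D → OneSliceAxiPropagation A D)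
    (hlsc : ∀ U : Set (EuclideanSpace ℝ (Fin 3)), IsWindowLsc (axiPhi A U))
    (hspread : ∀ U : Set (EuclideanSpace ℝ (Fin 3)), IsOpen U → U.Nonempty → SpreadsTo (axiPhi A U) (axiStratum A) ν) :
    TargetSeqAxisymAt ν M A :=
  targetSeqAxisymAt_of hν A h₁ (fun _ _ _ hc => floorSurvives_holds hc) h₃ hlsc hspread

/-- **DOOR T-axi-seq MODULO I1 ONLY:** for every viscosity `ν > 0`, every local Type-I bound `M` and EVERY axis `A e₃`,
`TargetSeqAxisymAt ν M A` follows from I1 `LocalPointZoomAlongTimesM` alone — I2a (`floorSurvives_holds`), I2b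
(`oneSliceAxiPropagation_holds`) and S26's (H1)/(H2) instance lemmas (`isWindowLsc_axiPhi` / `spreadsTo_axiPhi`) are
tree theorems. -/
theorem targetSeqAxisymAt_of_zoom {ν M : ℝ} (hν : 0 < ν) (A : EuclideanSpace ℝ (Fin 3) ≃ₗᵢ[ℝ] EuclideanSpace ℝ (Fin 3))
    (h₁ : LocalPointZoomAlongTimesM) : TargetSeqAxisymAt ν M A :=
  targetSeqAxisymAt_of_two hν A h₁ (fun D _ => oneSliceAxiPropagation_holds A D) (isWindowLsc_axiPhi A)
    fun _ hU hne => spreadsTo_axiPhi hν A hU hne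

/-- **T-axi-seq implies S26's eventual door T-axi** `StableStrataDoorDefs.TargetEpsAxisymAt ν M A` (same `ε`): eventual
smallness of the defect gives smallness along a sequence (`eventualDoor_of_seqDoor` + `physSmall_axiPhi`). -/
theorem targetEpsAxisymAt_of_seq {ν M : ℝ} {A : EuclideanSpace ℝ (Fin 3) ≃ₗᵢ[ℝ] EuclideanSpace ℝ (Fin 3)}
    (h : TargetSeqAxisymAt ν M A) : TargetEpsAxisymAt ν M A := by
  intro U hU hne hbdd
  obtain ⟨ε, hε, hdoor⟩ := eventualDoor_of_seqDoor (h U hU hne hbdd)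
  exact ⟨ε, hε, fun T hT u p hcl hLH hdec x₀ ρ hρ hM hsmall =>
    hdoor T hT u p hcl hLH hdec x₀ ρ hρ hM (physSmall_axiPhi hsmall)⟩

/-- **one-slice Liouville for the NULL stratum** `StableStrataDoorInstances.quietStratum`: a classical Type-I(`D`)
solution on `(−∞,0) × ℝ³` that vanishes at ONE time vanishes at every time — one-slice uniqueness
(`StableStrataDoorOneSliceAxiPropagation.eq_of_eq_slice_classical`: bounded-mild uniqueness forward, time analyticity
backward) against the rest state `(0, 0)` (`isClassicalNSSolutionOn_zero`). -/
theorem oneSliceLiouville_quiet (D : ℝ) : OneSliceLiouville quietStratum D := by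
  intro V q hcl hdec s₀ hs₀ hmem τ hτ x
  have h0cl : IsClassicalNSSolutionOn (Set.Iio 0) 1
      (0 : ℝ → EuclideanSpace ℝ (Fin 3) → EuclideanSpace ℝ (Fin 3)) 0 0 :=
    isClassicalNSSolutionOn_zero (Set.Iio 0) 1
  have h0dec : HasTypeIDecay 0 (0 : ℝ → EuclideanSpace ℝ (Fin 3) → EuclideanSpace ℝ (Fin 3)) :=
    fun t _ y => by simp
  have hslice : V s₀ = (0 : ℝ → EuclideanSpace ℝ (Fin 3) → EuclideanSpace ℝ (Fin 3)) s₀ := funext fun y => hmem y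
  have h := congrFun (eq_of_eq_slice_classical hcl hdec h0cl h0dec hs₀ hslice τ hτ) x
  simpa using h

/-- **DOOR T-quiet-seq MODULO I1 ONLY** «no Type-I blow-up whose similarity window is ε-QUIET ALONG SOME SEQUENCE of
times»: for every `ν > 0`, `M` and every open nonempty window `U` of similarity coordinates, I1 gives
`SeqDoorAt (quietPhi U) ν M` — `ε(ν, M, U) > 0` such that `∫_U √(T−tₙ)|u(tₙ, x₀ + √(T−tₙ)ζ)| dζ ≤ ε` along SOME `tₙ → T⁻`
excludes a singularity at `(x₀,T)` under space–time local Type I (`M`).  (The sequential form of S26's door T-quiet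
`targetQuietWindow_holds`; (H1)/(H2) are `isWindowLsc_quietPhi` / `spreadsTo_quietPhi`, I2b is replaced by
`oneSliceLiouville_quiet`.) -/
theorem seqDoorAt_quiet (h₁ : LocalPointZoomAlongTimesM) {ν M : ℝ} (hν : 0 < ν) {U : Set (EuclideanSpace ℝ (Fin 3))}
    (hU : IsOpen U) (hne : U.Nonempty) : SeqDoorAt (quietPhi U) ν M :=
  seqDoorAt_of_liouville hν h₁ (isWindowLsc_quietPhi U) (spreadsTo_quietPhi hν hU hne) fun D _ => oneSliceLiouville_quiet D

/-- a larger Type-I decay constant is still a Type-I decay constant. -/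
theorem hasTypeIDecay_mono {D D' : ℝ} {v : ℝ → EuclideanSpace ℝ (Fin 3) → EuclideanSpace ℝ (Fin 3)} (h : HasTypeIDecay D v)
    (hDD : D ≤ D') : HasTypeIDecay D' v := fun t ht x =>
  (h t ht x).trans (div_le_div_of_nonneg_right hDD (add_pos_of_nonneg_of_pos (norm_nonneg _) (Real.sqrt_pos.2 (by linarith))).le)

/-- **I1 = I1a + I1b (PROVED):** the prescribed-scale singular zoom plus the floor of singular Type-I profiles give I1 (the
space–time decay `M/ν` of the limit is the tree's `hasTypeIDecay_of_zoom`). -/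
theorem localPointZoomAlongTimesM_of_split (h₁ : LocalPointZoomAlongTimesSing) (h₂ : SingularProfileFloor) :
    LocalPointZoomAlongTimesM := by
  intro ν hν M
  obtain ⟨c, hc, hfl⟩ := h₂ (max (M / ν) 1) (lt_max_of_lt_right one_pos)
  refine ⟨c, hc, fun T hT u p hcl hLH hdec x₀ ρ hρ hM hnb t htT ht => ?_⟩
  obtain ⟨φ, C, v, lam, hφ, hlam, hlam2, hprof, hsing, hconv⟩ := h₁ ν hν M T hT u p hcl hLH hdec x₀ ρ hρ hM hnb t htT ht
  have hdecay : HasTypeIDecay (M / ν) v :=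
    Summit.NavierStokesRegularity.NavierStokesRegularity.Theorems.PlaneStrainDoorZoomSpaceTimeDecay.hasTypeIDecay_of_zoom
      hν hT hρ hlam (tendsto_lam_zero hφ ht hlam hlam2) hM hconv
  exact ⟨φ, C, v, lam, hφ, hlam, hlam2, hprof, hfl C v hprof (hasTypeIDecay_mono hdecay (le_max_left _ _)) hsing, hconv⟩

end Summit.NavierStokesRegularity.NavierStokesRegularity.Theorems.StableStrataDoorOneSliceAxiSeq
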